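import Summits.ABC.IUTFork.LDHSlotResidueSplitWitnessNV
import Literature.IUT.LogVolume.Corollary22Legendre
import Literature.IUT.LogVolume.Corollary22TwoAdicIntegrality
import HarnessLib

/-!
# Place arithmetic at a SPLIT prime: rational numbers at the places over `p`, a Chinese-remainder integer with a
# zero at one place and none at the other, and the valuations of its `j`-invariant (abc-iut cell, R2 S-chain team,
# seat abc-iut-s2-p3; toolkit for `LDHSplitDepthPoints`)

Record-only PROOF file (D-0012) of the abc-iut cell; classical arithmetic, TAKES NO SIDE on [IUTchIII] Cor. 3.12.
Dupuy–Hilado [DupuyHilado2025] §2.4.2 (`ord_v`), §2.5.4 (`v ∩ ℤ = p_vℤ`, `|κ(v)| = p_v^{f_v}`), §3.3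
(`j = 2^8(λ²−λ+1)^3/(λ²(λ−1)²)`, `ord_v(q_v) = −ord_v(j_E)`), §3.6 (`Pr(v) = n_v/[F:ℚ]`, `Σ_{v|p} n_v = [F:ℚ]`);
S. Mochizuki, *Arithmetic elliptic curves in general position* [MochizukiGenEll2010], Def. 1.5 (i) p. 8 (minimal field
of definition). PURPOSE: the (U)-line of crux `ThetaPartII` carries the CONE binder `hvol`/`hreg` whose arithmetic
content at `d_mod ≥ 2` is a local-height inequality at a bad/non-bad PAIR of places over one prime (abc-iut-S8/S7,
`LDHSlotResidue`, `LDHSlotResiduePointPair`); to exhibit GENUINE `λ`-line points where that pair exists with unbounded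
depth one needs: (1) `SplitDepth.intCast_mem_asIdeal_iff`, `ord_ratCast_pos_iff` / `ord_ratCast_neg_iff` — a rational
number has a zero (pole) at one place over `p` iff at all of them, so a split zero/pole certifies IRRATIONALITY
(`not_mem_bot_of_ord_pos_of_ord_eq_zero`, `…_of_ord_neg_of_ord_nonneg`) and, in a quadratic field, primitivity
(`adjoin_simple_eq_top_of_not_mem_bot`); (2) `SplitDepth.exists_integer` — CRT: `y ∈ v₀^M`, `y ≡ 2 (mod w)` at two
distinct places `v₀ ≠ w`; (3) its valuations: `ord_{v₀} y ≥ M`, `ord_w y = 0`, `ord_{v₀} j(y) ≤ −2M`, `0 ≤ ord_w j(y)`,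
`y ∉ ℚ`, `j(y) ∉ ℚ`; (4) `localDegree_eq_one` — at a split prime of a quadratic field `n_{v₀} = n_w = 1`,
`Pr = 1/2`, `ln N(v₀) = ln p`. Nothing about Θ-data or Cor. 3.12 here; typed ≠ proved. PROOF-ONLY file: no definitions.
[cite: DupuyHilado2025, §2.4.2, §2.5.4, §3.3, §3.6] [cite: MochizukiGenEll2010, Def 1.5 (i) p.8]
-/

noncomputable section

open NumberField IsDedekindDomain Literature.IUT.LogVolume
open Literature.NumberTheory.DiophantineGeometry.GenEll
open scoped IntermediateField

namespace Summit.ABC.IUTFork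

namespace SplitDepth

variable {F : Type} [Field F] [NumberField F] {p : ℕ} [hp : Fact p.Prime]

/-! ## Places over `p`: rational integers and primes in the ideal -/

/-- At a place `v ∣ p`: an integer `n` lies in `v` iff `p ∣ n` (`v ∩ ℤ = pℤ`). [cite: DupuyHilado2025, §2.5.4] -/
theorem intCast_mem_asIdeal_iff (v : placesOver F p) (n : ℤ) : (n : 𝓞 F) ∈ v.1.asIdeal ↔ (p : ℤ) ∣ n := by
  haveI : v.1.asIdeal.LiesOver (Ideal.span {(p : ℤ)}) := (mem_placesOver_iff v.1).mp v.2
  have h : Ideal.span {(p : ℤ)} = v.1.asIdeal.under ℤ := Ideal.LiesOver.over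
  have h2 : (n : 𝓞 F) ∈ v.1.asIdeal ↔ n ∈ v.1.asIdeal.under ℤ := by
    rw [Ideal.under_def, Ideal.mem_comap, eq_intCast]
  rw [h2, ← h, Ideal.mem_span_singleton]

/-- At a place `v ∣ p`: a natural number `n` lies in `v` iff `p ∣ n`. [cite: DupuyHilado2025, §2.5.4] -/
theorem natCast_mem_asIdeal_iff (v : placesOver F p) (n : ℕ) : (n : 𝓞 F) ∈ v.1.asIdeal ↔ p ∣ n := by
  have h := intCast_mem_asIdeal_iff v (n : ℤ)
  rw [Int.cast_natCast, Int.natCast_dvd_natCast] at h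
  exact h

/-- A prime `q ≠ p` is a unit at every place over `p`: `q ∉ v`. [cite: DupuyHilado2025, §2.5.4] -/
theorem natCast_not_mem_of_prime_ne (v : placesOver F p) {q : ℕ} (hq : q.Prime) (hqp : q ≠ p) :
    (q : 𝓞 F) ∉ v.1.asIdeal := by
  rw [natCast_mem_asIdeal_iff]
  exact fun h => hqp ((Nat.prime_dvd_prime_iff_eq hp.out hq).mp h).symm

/-! ## `ord_v` of algebraic integers -/

/-- An algebraic integer outside `v` has `ord_v = 0`. [cite: DupuyHilado2025, §2.4.2] -/
theorem ord_coe_eq_zero_of_not_mem (v : HeightOneSpectrum (𝓞 F)) {y : 𝓞 F} (hy : y ∉ v.asIdeal) :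
    ord F v (y : F) = 0 := by
  have hy0 : y ≠ 0 := fun h => hy (h ▸ v.asIdeal.zero_mem)
  have h1 := ord_nonneg_of_isIntegral F v y
  have h2 : ¬ 0 < ord F v (y : F) := fun h => hy ((ord_pos_iff_mem F v y hy0).mp h)
  omega

/-- An algebraic integer in `v^n` has `ord_v ≥ n`. [cite: DupuyHilado2025, §2.4.2] -/
theorem le_ord_coe_of_mem_pow (v : HeightOneSpectrum (𝓞 F)) {y : 𝓞 F} (hy0 : y ≠ 0) {n : ℕ}
    (hy : y ∈ v.asIdeal ^ n) : (n : ℤ) ≤ ord F v (y : F) := by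
  have h := (HeightOneSpectrum.intValuation_le_pow_iff_mem v y n).mpr hy
  have hne : v.intValuation y ≠ 0 := v.intValuation_ne_zero y hy0
  have hlog := (WithZero.log_le_log hne WithZero.exp_ne_zero).mpr h
  rw [WithZero.log_exp] at hlog
  unfold ord
  rw [show ((y : 𝓞 F) : F) = algebraMap (𝓞 F) F y from rfl, HeightOneSpectrum.valuation_of_algebraMap]
  omega

/-! ## Rational numbers at the places over `p` -/

/-- `ord_v` of a nonzero integer at `v ∣ p` is positive iff `p` divides it, and zero otherwise.
[cite: DupuyHilado2025, §2.4.2] -/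
theorem ord_intCast_pos_iff (v : placesOver F p) {n : ℤ} (hn : n ≠ 0) :
    0 < ord F v.1 (n : F) ↔ (p : ℤ) ∣ n := by
  have hn' : (n : 𝓞 F) ≠ 0 := by exact_mod_cast hn
  rw [← intCast_mem_asIdeal_iff v n, ← ord_pos_iff_mem F v.1 (n : 𝓞 F) hn']
  exact Iff.rfl

/-- `ord_v(n) = 0` at `v ∣ p` for an integer `n` prime to `p`. [cite: DupuyHilado2025, §2.4.2] -/
theorem ord_intCast_eq_zero (v : placesOver F p) {n : ℤ} (hn : ¬ (p : ℤ) ∣ n) : ord F v.1 (n : F) = 0 := by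
  have h : (n : 𝓞 F) ∉ v.1.asIdeal := fun h => hn ((intCast_mem_asIdeal_iff v n).mp h)
  have h0 : ord F v.1 ((n : 𝓞 F) : F) = 0 := ord_coe_eq_zero_of_not_mem v.1 h
  have hc : ((n : 𝓞 F) : F) = (n : F) := rfl
  rw [hc] at h0
  exact h0

/-- **A rational number has a zero at a place over `p` iff `p` divides its numerator** (`r = a/b` reduced:
`ord_v(r) = ord_v(a) − ord_v(b)` and at most one of `a, b` is divisible by `p`). [cite: DupuyHilado2025, §2.4.2] -/
theorem ord_ratCast_pos_iff (v : placesOver F p) {r : ℚ} (hr : r ≠ 0) :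
    0 < ord F v.1 (r : F) ↔ (p : ℤ) ∣ r.num := by
  have hnum : r.num ≠ 0 := Rat.num_ne_zero.mpr hr
  have hden : (r.den : ℤ) ≠ 0 := by exact_mod_cast r.den_nz
  have hnumF : (r.num : F) ≠ 0 := by exact_mod_cast hnum
  have hdenF : ((r.den : ℤ) : F) ≠ 0 := by exact_mod_cast hden
  have hcast : (r : F) = (r.num : F) * (((r.den : ℤ) : F))⁻¹ := by
    rw [Rat.cast_def, div_eq_mul_inv]; push_cast; rfl
  have hord : ord F v.1 (r : F) = ord F v.1 (r.num : F) - ord F v.1 ((r.den : ℤ) : F) := by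
    rw [hcast, ord_mul F v.1 hnumF (inv_ne_zero hdenF), ord_inv]; ring
  have hcop : ¬ ((p : ℤ) ∣ r.num ∧ (p : ℤ) ∣ (r.den : ℤ)) := by
    rintro ⟨h1, h2⟩
    have h3 : (p : ℤ) ∣ (Int.gcd r.num r.den : ℤ) := Int.dvd_coe_gcd h1 h2
    have h4 : Int.gcd r.num (r.den : ℤ) = 1 := by
      rw [Int.gcd_eq_natAbs, Int.natAbs_natCast]; exact r.reduced
    rw [h4] at h3
    have : (p : ℤ) ≤ 1 := Int.le_of_dvd one_pos h3
    have : 1 < p := hp.out.one_lt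
    omega
  constructor
  · intro h
    by_contra hnd
    have h0 := ord_intCast_eq_zero v hnd
    have h1 : 0 ≤ ord F v.1 ((r.den : ℤ) : F) := by
      have := ord_nonneg_of_isIntegral F v.1 ((r.den : ℤ) : 𝓞 F)
      push_cast at this ⊢
      exact this
    rw [hord, h0] at h
    omega
  · intro h
    have h1 := (ord_intCast_pos_iff v hnum).mpr h
    have h2 : ord F v.1 ((r.den : ℤ) : F) = 0 := ord_intCast_eq_zero v (fun h' => hcop ⟨h, h'⟩)
    rw [hord, h2, sub_zero]
    exact h1

/-- **A rational number has a pole at a place over `p` iff `p` divides its denominator.**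
[cite: DupuyHilado2025, §2.4.2] -/
theorem ord_ratCast_neg_iff (v : placesOver F p) {r : ℚ} (hr : r ≠ 0) :
    ord F v.1 (r : F) < 0 ↔ (p : ℤ) ∣ (r.den : ℤ) := by
  have hr' : r⁻¹ ≠ 0 := inv_ne_zero hr
  have h := ord_ratCast_pos_iff v hr'
  rw [Rat.cast_inv, ord_inv, Rat.num_inv, neg_pos] at h
  rw [h]
  rcases lt_trichotomy r.num 0 with hlt | heq | hgt
  · rw [Int.sign_eq_neg_one_of_neg hlt]; simp
  · exact absurd (Rat.num_ne_zero.mpr hr) (not_not.mpr heq)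
  · rw [Int.sign_eq_one_of_pos hgt]; simp

/-- The sign of `ord_v` of a rational number does not depend on the place `v` over `p`: zeros.
[cite: DupuyHilado2025, §2.4.2] -/
theorem ord_ratCast_pos_iff_pos (v w : placesOver F p) {r : ℚ} (hr : r ≠ 0) :
    0 < ord F v.1 (r : F) ↔ 0 < ord F w.1 (r : F) := by
  rw [ord_ratCast_pos_iff v hr, ord_ratCast_pos_iff w hr]

/-- The sign of `ord_v` of a rational number does not depend on the place `v` over `p`: poles.
[cite: DupuyHilado2025, §2.4.2] -/
theorem ord_ratCast_neg_iff_neg (v w : placesOver F p) {r : ℚ} (hr : r ≠ 0) :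
    ord F v.1 (r : F) < 0 ↔ ord F w.1 (r : F) < 0 := by
  rw [ord_ratCast_neg_iff v hr, ord_ratCast_neg_iff w hr]

/-- **Irrationality from a split zero**: an element of `F` with a zero at one place over `p` and `ord = 0` at another
is not rational. [cite: MochizukiGenEll2010, Def 1.5 (i) p.8] -/
theorem not_mem_bot_of_ord_pos_of_ord_eq_zero (v w : placesOver F p) {z : F} (hv : 0 < ord F v.1 z)
    (hw : ord F w.1 z = 0) : z ∉ (⊥ : IntermediateField ℚ F) := by
  rw [IntermediateField.mem_bot]
  rintro ⟨r, rfl⟩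
  rw [eq_ratCast] at hv hw
  have hr : r ≠ 0 := by rintro rfl; simp [ord_zero] at hv
  have := (ord_ratCast_pos_iff_pos v w hr).mp hv
  omega

/-- **Irrationality from a split pole**: an element of `F` with a pole at one place over `p` and `ord ≥ 0` at another
is not rational. [cite: MochizukiGenEll2010, Def 1.5 (i) p.8] -/
theorem not_mem_bot_of_ord_neg_of_ord_nonneg (v w : placesOver F p) {z : F} (hv : ord F v.1 z < 0)
    (hw : 0 ≤ ord F w.1 z) : z ∉ (⊥ : IntermediateField ℚ F) := by
  rw [IntermediateField.mem_bot]
  rintro ⟨r, rfl⟩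
  rw [eq_ratCast] at hv hw
  have hr : r ≠ 0 := by rintro rfl; simp [ord_zero] at hv
  have := (ord_ratCast_neg_iff_neg v w hr).mp hv
  omega

/-- In a quadratic field an irrational element is primitive: `ℚ(z) = F`. [cite: MochizukiGenEll2010, Def 1.5 (i) p.8] -/
theorem adjoin_simple_eq_top_of_not_mem_bot (hF : Module.finrank ℚ F = 2) {z : F}
    (hz : z ∉ (⊥ : IntermediateField ℚ F)) : ℚ⟮z⟯ = ⊤ := by
  haveI := IntermediateField.isSimpleOrder_of_finrank_prime ℚ F (by rw [hF]; exact Nat.prime_two)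
  rcases eq_bot_or_eq_top ℚ⟮z⟯ with h | h
  · exact absurd (IntermediateField.adjoin_simple_eq_bot_iff.mp h) hz
  · exact h

/-! ## The Chinese-remainder integer and its valuations -/

omit hp in
/-- **CRT**: at two distinct places `v₀ ≠ w` of `F` (over `p`), for every `M` there is an algebraic integer `y` with
`y ∈ v₀^M` and `y ≡ 2 (mod w)`. [cite: DupuyHilado2025, §2.4.2] -/
theorem exists_integer (v₀ w : placesOver F p) (hvw : w ≠ v₀) (M : ℕ) :
    ∃ y : 𝓞 F, y ∈ v₀.1.asIdeal ^ M ∧ y - 2 ∈ w.1.asIdeal := by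
  classical
  have hne : v₀.1.asIdeal ≠ w.1.asIdeal := fun h => hvw (Subtype.ext (HeightOneSpectrum.ext h)).symm
  obtain ⟨y, hy⟩ := IsDedekindDomain.exists_forall_sub_mem_ideal (s := (Finset.univ : Finset Bool))
    (fun b => if b then v₀.1.asIdeal else w.1.asIdeal) (fun b => if b then M else 1)
    (fun b _ => by cases b <;> exact HeightOneSpectrum.prime _)
    (fun b _ c _ hbc => by
      cases b <;> cases c
      · exact absurd rfl hbc
      · exact hne.symm
      · exact hne
      · exact absurd rfl hbc)
    (fun b => if b.1 then 0 else 2)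
  refine ⟨y, ?_, ?_⟩
  · simpa using hy true (Finset.mem_univ _)
  · simpa using hy false (Finset.mem_univ _)

section Integer

variable (v₀ w : placesOver F p) {M : ℕ} {y : 𝓞 F}

omit hp in
/-- `y ∈ v₀` when `y ∈ v₀^M`, `M ≥ 1`. [cite: DupuyHilado2025, §2.4.2] -/
theorem integer_mem (hM : 1 ≤ M) (hy : y ∈ v₀.1.asIdeal ^ M) : y ∈ v₀.1.asIdeal :=
  Ideal.pow_le_self (by omega) hy

/-- `y ∉ w` when `y ≡ 2 (mod w)` (else `2 ∈ w`, but `w ∣ p ≠ 2`). [cite: DupuyHilado2025, §2.4.2] -/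
theorem integer_not_mem (hp2 : p ≠ 2) (hy2 : y - 2 ∈ w.1.asIdeal) : y ∉ w.1.asIdeal := fun h => by
  have h2 : (2 : 𝓞 F) ∈ w.1.asIdeal := by
    have := w.1.asIdeal.sub_mem h hy2
    convert this using 1; ring
  exact natCast_not_mem_of_prime_ne w Nat.prime_two (Ne.symm hp2) h2

/-- `y ≠ 0` when `y ≡ 2 (mod w)`. [cite: DupuyHilado2025, §2.4.2] -/
theorem integer_ne_zero (hp2 : p ≠ 2) (hy2 : y - 2 ∈ w.1.asIdeal) : y ≠ 0 :=
  fun h => integer_not_mem w hp2 hy2 (h ▸ w.1.asIdeal.zero_mem)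

omit hp in
/-- `y − 1 ∉ v₀` (as `y ∈ v₀`). [cite: DupuyHilado2025, §2.4.2] -/
theorem integer_sub_one_not_mem_v (hM : 1 ≤ M) (hy : y ∈ v₀.1.asIdeal ^ M) : y - 1 ∉ v₀.1.asIdeal := fun h => by
  have h1 : (1 : 𝓞 F) ∈ v₀.1.asIdeal := by
    have := v₀.1.asIdeal.sub_mem (integer_mem v₀ hM hy) h
    convert this using 1; ring
  exact v₀.1.isPrime.ne_top ((Ideal.eq_top_iff_one _).mpr h1)

omit hp in
/-- `y − 1 ∉ w` (as `y − 2 ∈ w`). [cite: DupuyHilado2025, §2.4.2] -/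
theorem integer_sub_one_not_mem_w (hy2 : y - 2 ∈ w.1.asIdeal) : y - 1 ∉ w.1.asIdeal := fun h => by
  have h1 : (1 : 𝓞 F) ∈ w.1.asIdeal := by
    have := w.1.asIdeal.sub_mem h hy2
    convert this using 1; ring
  exact w.1.isPrime.ne_top ((Ideal.eq_top_iff_one _).mpr h1)

omit hp in
/-- `y² − y + 1 ∉ v₀` (as `y ∈ v₀`). [cite: DupuyHilado2025, §2.4.2] -/
theorem integer_quad_not_mem_v (hM : 1 ≤ M) (hy : y ∈ v₀.1.asIdeal ^ M) : y ^ 2 - y + 1 ∉ v₀.1.asIdeal :=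
  fun h => by
  have hyy : y ^ 2 - y ∈ v₀.1.asIdeal := by
    have := v₀.1.asIdeal.mul_mem_left (y - 1) (integer_mem v₀ hM hy)
    convert this using 1; ring
  have h1 : (1 : 𝓞 F) ∈ v₀.1.asIdeal := by
    have := v₀.1.asIdeal.sub_mem h hyy
    convert this using 1; ring
  exact v₀.1.isPrime.ne_top ((Ideal.eq_top_iff_one _).mpr h1)

/-- `2^8·(y² − y + 1)^3 ∉ v₀`. [cite: DupuyHilado2025, §2.4.2] -/
theorem integer_num_not_mem_v (hp2 : p ≠ 2) (hM : 1 ≤ M) (hy : y ∈ v₀.1.asIdeal ^ M) :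
    (2 : 𝓞 F) ^ 8 * (y ^ 2 - y + 1) ^ 3 ∉ v₀.1.asIdeal := fun h => by
  rcases v₀.1.isPrime.mem_or_mem h with h2 | h3
  · exact natCast_not_mem_of_prime_ne v₀ Nat.prime_two (Ne.symm hp2) (v₀.1.isPrime.mem_of_pow_mem 8 h2)
  · exact integer_quad_not_mem_v v₀ hM hy (v₀.1.isPrime.mem_of_pow_mem 3 h3)

/-- `ord_{v₀}(y) ≥ M`. [cite: DupuyHilado2025, §2.4.2] -/
theorem le_ord_v (hp2 : p ≠ 2) (hy : y ∈ v₀.1.asIdeal ^ M) (hy2 : y - 2 ∈ w.1.asIdeal) :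
    (M : ℤ) ≤ ord F v₀.1 (y : F) :=
  le_ord_coe_of_mem_pow v₀.1 (integer_ne_zero w hp2 hy2) hy

/-- `ord_w(y) = 0`. [cite: DupuyHilado2025, §2.4.2] -/
theorem ord_w (hp2 : p ≠ 2) (hy2 : y - 2 ∈ w.1.asIdeal) : ord F w.1 (y : F) = 0 :=
  ord_coe_eq_zero_of_not_mem w.1 (integer_not_mem w hp2 hy2)

omit [NumberField F] in
/-- The `j`-invariant of `y` as (algebraic-integer numerator)/(denominator):
`j(y) = (2^8(y²−y+1)^3)·(y²(y−1)²)⁻¹`. [cite: DupuyHilado2025, §3.3] -/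
theorem jInv_coe_eq (y : 𝓞 F) : Cor22.jInv (y : F) = (((2 : 𝓞 F) ^ 8 * (y ^ 2 - y + 1) ^ 3 : 𝓞 F) : F) *
    ((y : F) ^ 2 * (((y - 1 : 𝓞 F) : F)) ^ 2)⁻¹ := by
  unfold Cor22.jInv
  rw [div_eq_mul_inv]
  push_cast
  rfl

/-- **`ord_{v₀} j(y) ≤ −2M`**: `j(y) = 2^8(y²−y+1)^3/(y²(y−1)²)` with numerator a `v₀`-unit and `ord_{v₀}(y−1) = 0`.
[cite: DupuyHilado2025, §3.3] -/
theorem ord_jInv_v_le (hp2 : p ≠ 2) (hM : 1 ≤ M) (hy : y ∈ v₀.1.asIdeal ^ M) (hy2 : y - 2 ∈ w.1.asIdeal) :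
    ord F v₀.1 (Cor22.jInv (y : F)) ≤ -(2 * M : ℤ) := by
  have hy0 : (y : F) ≠ 0 := by exact_mod_cast integer_ne_zero w hp2 hy2
  have hy1 : ((y - 1 : 𝓞 F) : F) ≠ 0 := by
    have : y - 1 ≠ 0 := fun h => integer_sub_one_not_mem_v v₀ hM hy (h ▸ v₀.1.asIdeal.zero_mem)
    exact_mod_cast this
  have hA : (((2 : 𝓞 F) ^ 8 * (y ^ 2 - y + 1) ^ 3 : 𝓞 F) : F) ≠ 0 := by
    have : (2 : 𝓞 F) ^ 8 * (y ^ 2 - y + 1) ^ 3 ≠ 0 := fun h =>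
      integer_num_not_mem_v v₀ hp2 hM hy (h ▸ v₀.1.asIdeal.zero_mem)
    exact_mod_cast this
  have hB : (y : F) ^ 2 * (((y - 1 : 𝓞 F) : F)) ^ 2 ≠ 0 := mul_ne_zero (pow_ne_zero _ hy0) (pow_ne_zero _ hy1)
  rw [jInv_coe_eq, ord_mul F v₀.1 hA (inv_ne_zero hB), ord_inv, ord_coe_eq_zero_of_not_mem v₀.1
    (integer_num_not_mem_v v₀ hp2 hM hy), ord_mul F v₀.1 (pow_ne_zero _ hy0) (pow_ne_zero _ hy1),
    ord_pow, ord_pow, ord_coe_eq_zero_of_not_mem v₀.1 (integer_sub_one_not_mem_v v₀ hM hy)]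
  have := le_ord_v v₀ w hp2 hy hy2
  push_cast
  omega

/-- **`0 ≤ ord_w j(y)`**: the denominator `y²(y−1)²` is a `w`-unit, the numerator an algebraic integer.
[cite: DupuyHilado2025, §3.3] -/
theorem ord_jInv_w_nonneg (hp2 : p ≠ 2) (hM : 1 ≤ M) (hy : y ∈ v₀.1.asIdeal ^ M) (hy2 : y - 2 ∈ w.1.asIdeal) :
    0 ≤ ord F w.1 (Cor22.jInv (y : F)) := by
  have hy0 : (y : F) ≠ 0 := by exact_mod_cast integer_ne_zero w hp2 hy2
  have hy1 : ((y - 1 : 𝓞 F) : F) ≠ 0 := by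
    have : y - 1 ≠ 0 := fun h => integer_sub_one_not_mem_v v₀ hM hy (h ▸ v₀.1.asIdeal.zero_mem)
    exact_mod_cast this
  have hA : (((2 : 𝓞 F) ^ 8 * (y ^ 2 - y + 1) ^ 3 : 𝓞 F) : F) ≠ 0 := by
    have : (2 : 𝓞 F) ^ 8 * (y ^ 2 - y + 1) ^ 3 ≠ 0 := fun h =>
      integer_num_not_mem_v v₀ hp2 hM hy (h ▸ v₀.1.asIdeal.zero_mem)
    exact_mod_cast this
  have hB : (y : F) ^ 2 * (((y - 1 : 𝓞 F) : F)) ^ 2 ≠ 0 := mul_ne_zero (pow_ne_zero _ hy0) (pow_ne_zero _ hy1)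
  rw [jInv_coe_eq, ord_mul F w.1 hA (inv_ne_zero hB), ord_inv, ord_mul F w.1 (pow_ne_zero _ hy0) (pow_ne_zero _ hy1),
    ord_pow, ord_pow, ord_w w hp2 hy2, ord_coe_eq_zero_of_not_mem w.1 (integer_sub_one_not_mem_w w hy2)]
  have := ord_nonneg_of_isIntegral F w.1 ((2 : 𝓞 F) ^ 8 * (y ^ 2 - y + 1) ^ 3)
  push_cast at this ⊢
  omega

/-- `y ∉ ℚ` (a zero at `v₀`, none at `w`). [cite: MochizukiGenEll2010, Def 1.5 (i) p.8] -/
theorem integer_not_mem_bot (hp2 : p ≠ 2) (hM : 1 ≤ M) (hy : y ∈ v₀.1.asIdeal ^ M) (hy2 : y - 2 ∈ w.1.asIdeal) :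
    (y : F) ∉ (⊥ : IntermediateField ℚ F) :=
  not_mem_bot_of_ord_pos_of_ord_eq_zero v₀ w (by have := le_ord_v v₀ w hp2 hy hy2; omega) (ord_w w hp2 hy2)

/-- `j(y) ∉ ℚ` (a pole at `v₀`, none at `w`). [cite: MochizukiGenEll2010, Def 1.5 (i) p.8] -/
theorem jInv_not_mem_bot (hp2 : p ≠ 2) (hM : 1 ≤ M) (hy : y ∈ v₀.1.asIdeal ^ M) (hy2 : y - 2 ∈ w.1.asIdeal) :
    Cor22.jInv (y : F) ∉ (⊥ : IntermediateField ℚ F) :=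
  not_mem_bot_of_ord_neg_of_ord_nonneg v₀ w (by have := ord_jInv_v_le v₀ w hp2 hM hy hy2; omega)
    (ord_jInv_w_nonneg v₀ w hp2 hM hy hy2)

end Integer

/-! ## Local degrees at a split prime of a quadratic field -/

/-- In a quadratic field with two distinct places `v₀ ≠ w` over `p`, both have local degree `n = 1` (fundamental
identity `Σ_{v|p} n_v = 2`). [cite: DupuyHilado2025, §3.6] -/
theorem localDegree_eq_one (hF : Module.finrank ℚ F = 2) (v₀ w : placesOver F p) (hvw : w ≠ v₀) :
    localDegree F v₀.1 = 1 ∧ localDegree F w.1 = 1 := by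
  classical
  have hsum := sum_localDegree F p
  have hne : v₀.1 ≠ w.1 := fun h => hvw (Subtype.ext h).symm
  have hsub : ({v₀.1, w.1} : Finset (HeightOneSpectrum (𝓞 F))) ⊆ placesOver F p := by
    intro u hu
    rcases Finset.mem_insert.mp hu with rfl | hu
    · exact v₀.2
    · rw [Finset.mem_singleton] at hu; rw [hu]; exact w.2
  have hle := Finset.sum_le_sum_of_subset_of_nonneg hsub (fun u _ _ => (localDegree_pos F u).le)
  rw [Finset.sum_pair hne, hsum, hF] at hle
  have h1 := localDegree_pos F v₀.1
  have h2 := localDegree_pos F w.1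
  omega

/-- Hence `Pr(v₀) = 1/2`, `ln N(v₀) = ln p` at such a place. [cite: DupuyHilado2025, §2.5.4, §3.6] -/
theorem weight_eq_half_and_logNorm_eq (hF : Module.finrank ℚ F = 2) (v₀ w : placesOver F p) (hvw : w ≠ v₀) :
    weight F v₀.1 = 1 / 2 ∧ logNorm F v₀.1 = Real.log p := by
  have h1 := (localDegree_eq_one hF v₀ w hvw).1
  refine ⟨by rw [weight, h1, hF]; norm_num, ?_⟩
  have hres : resDeg F v₀.1 = 1 := by
    unfold localDegree at h1
    exact Nat.eq_one_of_mul_eq_one_left h1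
  rw [logNorm_eq, hres, (mem_placesOver_iff_residueChar v₀.1).mp v₀.2]
  simp

end SplitDepth

end Summit.ABC.IUTFork

end
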